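import Summits.BirchSwinnertonDyer.BirchSwinnertonDyer.Theorems.ResidualThetaTransportAtTwoResidualSignedLambdaLowerCMAtTwoCofreeLimitFamilyFloor
import HarnessLib

/-!
# The 2-adic VALUE TRANSFER of the deep half of RSL_g («transfer = restriction»): levelwise value conditions on the reductions
# `red_{p^k}(proj_n x) ∈ Sol n k` ⇒ `locd₂ x = z` for the PINNED glue `locd₂`, plus the `[p]_*` / `Cor`-stability of the value condition

Route `ResidualThetaTransportAtTwo` (RTT), crux RSL_g `ResidualSignedLambdaLowerCMAtTwo` (stmt-BirchSwinnertonDyer-22608); seat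
`prover-bsd-wall-tp2-p2x` g18 (`--supports 22608 --as helper`, closes nothing). THEOREMS ONLY (no definition, no named fact, no instance,
no `sorry`). STUB-PLAN `stub_cmLambdaLower` rev 18 §3 items 7/8 (split stubs S4₂ `stub_deepHalfAtTwoStrict` / S4₀ `stub_deepHalfAwayTwo` of
`Cruxes/ResidualSignedLambdaLowerCMAtTwo/Lines/onepair.lean`), step «(B9) transfer = restriction (V42)»: the Kőnig bookkeeping
(`ThetaTransport.exists_iwasawaH1_of_levelwise_from`, file `…CofreeLimitFamilyFloor.lean`) outputs `x : 𝐇¹_Γ(T_ρ)` with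
`red_{p^k}(proj_n x) ∈ Sol n k` for `N₀ ≤ n`; the deep-half CONCLUSION is about the pinned glue `locd₂ x` (v2c binders: the family
`pair m : H¹(Γ_m, T_ρ) →+ ((Fin r → E(ℚ_{m,v})) →+ ℤ_p)` PINNED by its residues `hpair : (pair m x Q) mod p^k = rhoLayerPairingPk … m k x Q`,
and `locd₂` PINNED by the layer formula `hlocd : locd₂ x Q = pair m (proj m x) Q` on layer-`m` tuples). This file is the glue between the two:

* §1 (generic coefficients `T`, any place `v`, any `pair`/`locd` with the layer formula — serves the `S₀`-side pins verbatim once they are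
  typed in the same currency): `locd_eq_of_forall_layer_from` — if `pair n (proj n x) Q = z Q` for every layer-`n` tuple `Q`, `N₀ ≤ n`, then
  `locd x = z` (every tuple of tower points lies in a common layer `≥ N₀`); residue form `locd_eq_of_forall_toZModPow_eq_from`
  (`ℤ_p` is `p`-adically separated); the strict readings `locd_eq_zero_of_forall_layer_from` / `…_toZModPow_eq_zero_from` (`z = 0`).
* §2 (`ρ`, the residue pin `hpair`): `locd₂_eq_of_forall_rhoLayerPairingPk_eq_from` — if `rhoLayerPairingPk … n k (proj n x) Q = (z Q) mod p^k`
  for all `k`, all layer-`n` tuples, `N₀ ≤ n`, then `locd₂ x = z`.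
* §3 the VALUE CONDITION on torsion classes `c ∈ H¹(Γ_n, A_ρ[p^k])` for a target functional `z` (stated inline, no definition):
  `∀ Q ∈ E(ℚ_{n,v})^r, layerPairingH1Of (layerLocOf c) (thetaLayerKummer Q) = (z Q) mod p^k`. It is `[p]_*`-STABLE for a TOWER `ePk`
  (`valueCond_cohomologyMap_cofreeTorsionPow`: `layerLocOf_cohomologyMap`, `layerPairingH1Of_succ_compat`,
  `cohomologyMap_cofreeTorsionLocalPow_thetaLayerKummer`, `PadicInt.cast_toZModPow`) and `Cor`-STABLE at `v ∣ p` for the cyclotomic `κ`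
  (`valueCond_layerCores`: `layerPairingOf_layerCores` + `resLe_thetaLayerKummer`) — i.e. the value part of `Sol n k` satisfies the
  `hSk` / `hSn` hypotheses of the Kőnig files; and `red_{p^k}(y) ` satisfies it iff `rhoLayerPairingPk n k y Q = (z Q) mod p^k`
  (`rhoLayerPairingPk_apply`, `rfl`).
* §4 Sol-form transfer `locd₂_eq_of_forall_reduce_proj_mem_from` and the composite
  `exists_iwasawaH1_locd₂_eq_of_levelwise_from` = `exists_iwasawaH1_of_levelwise_from` + transfer: finite / diagonally non-empty /
  `[p]_*`- and `Cor`-stable solution sets from a floor whose members satisfy the value condition for `z` yield `x : I.H` with `locd₂ x = z`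
  AND `red_{p^k}(proj_n x) ∈ Sol n k` (`N₀ ≤ n`) — the latter kept for the `S₀`-side transfer of the same `x`. The expected slack `a = 1`
  of the S4₂ text (`∃ a ≠ 0, …, a • z = locd₂ x`; STUB-PLAN S48) is recorded as `exists_ne_zero_smul_eq_of_eq`.

No pins are constructed, no `selmerComplement` call is made (the diagonal non-emptiness `hne` — the Poitou–Tate content — stays the
stub holder's hypothesis), no Θ is built; BSD is not proved by any of this; RSL_g (22608) and the K3 crux (20308) stay OPEN.

References: [Kato2004Asterisque] §12.2 (p. 220), §13.8 (pp. 228–229), §17.13 (p. 279); [PerrinRiou1994Invent] §3.6.1; [Kobayashi2003]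
(8.23) (p. 18); [Rubin2000] App. B Prop. B.2.3, §B.3; [Sprung2012] Lemma 7.10 (p. 1503); [NeukirchSchmidtWingberg2008] I §5 (1.5.3)(iv),
I §6 (1.6.4). Tree: `…RhoLayerPairingProjection.lean` (K-c: `exists_common_layer`, `layerPairingOf_layerCores`, `resLe_thetaLayerKummer`,
`exists_locd₂_of_layerCores`), `…RhoLayerPairingTower.lean` (`layerPairingH1Of_succ_compat`), `…RhoLayerPairingCompat.lean`
(`layerLocOf_cohomologyMap`, `cohomologyMap_cofreeTorsionLocalPow_thetaLayerKummer`), `…CofreeLimitFamilyFloor.lean`,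
`Literature/…/CyclotomicLayerRhoTatePairingPk.lean` (`rhoLayerPairingPk_apply`).
-/

set_option autoImplicit false
-- the Theorems namespace of this sub repeats the summit name by design (D-0017 nested layout)
set_option linter.dupNamespace false

noncomputable section

open scoped Classical

namespace Summit.BirchSwinnertonDyer.BirchSwinnertonDyer.Theorems.ThetaTransport.DeepHalfTransfer

open CategoryTheory Field NumberField IsDedekindDomain WeierstrassCurve
  Literature.NumberTheory.EllipticCurves Literature.NumberTheory.GaloisRepresentations
  Literature.NumberTheory.EllipticCurves.Kobayashi2003 Literature.NumberTheory.EllipticCurves.Sprung2012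
  Literature.NumberTheory.EllipticCurves.GreenbergSelmer Literature.NumberTheory.EllipticCurves.CyclotomicLayer
  Literature.NumberTheory.EllipticCurves.Kato2004
  Literature.NumberTheory.GaloisCohomology ZpExtension
  Summit.BirchSwinnertonDyer.BirchSwinnertonDyer.Theorems.ThetaTransport

/-! ## §1 Generic coefficients: the layer formula transfers levelwise values to the glue -/

section Generic

variable {p : ℕ} [Fact p.Prime] {A : Type} [CommRing A] [TopologicalSpace A] {M : Type} [AddCommGroup M] [Module A M]
  [TopologicalSpace M] [IsTopologicalAddGroup M] [ContinuousSMul A M] {T : GaloisRep ℚ A M}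
  {κ : ZpExtension ℚ p} {γ : absoluteGaloisGroup ℚ} (I : IwasawaH1DataCoeff T p κ γ)
  (W : WeierstrassCurve ℚ) (v : HeightOneSpectrum (𝓞 ℚ)) {r : ℕ}
  (pair : ∀ n : ℕ, H1 T (κ.layerSubgroup n) →+
    ((Fin r → localLayerPointsOfEmb κ (closureEmb (K := ℚ) (v.adicCompletion ℚ)) W n) →+ ℤ_[p]))
  {locd : I.H →+ ((Fin r → localTowerPointsOfEmb κ (closureEmb (K := ℚ) (v.adicCompletion ℚ)) W) →+ ℤ_[p])}
  (hlocd : ∀ (n : ℕ) (x : I.H) (Q : Fin r → localPoints W (v.adicCompletion ℚ))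
    (hQ : ∀ i, Q i ∈ localLayerPointsOfEmb κ (closureEmb (K := ℚ) (v.adicCompletion ℚ)) W n),
    locd x (fun i => ⟨Q i, localLayerPointsOfEmb_le_localTowerPointsOfEmb κ _ W n (hQ i)⟩) = pair n (I.proj n x) (fun i => ⟨Q i, hQ i⟩))

include hlocd in
/-- **Transfer = restriction (generic).** If the layer pairings of the projections of `x ∈ 𝐇¹_Γ(T)` take the values of ONE functional `z`
on tower tuples — `pair n (proj n x) Q = z Q` for every tuple `Q` of points of the layer `n`, for all `n ≥ N₀` — then the glue satisfies
`locd x = z`: every tuple of tower points lies in a common layer `≥ N₀` (`exists_common_layer`) and the layer formula `hlocd` evaluates `locd x`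
there. [cite: Sprung2012, Lemma 7.10 (p. 1503)] [cite: Kato2004Asterisque, §12.2 (p. 220)] [cite: PerrinRiou1994Invent, §3.6.1] -/
theorem locd_eq_of_forall_layer_from (N₀ : ℕ) (x : I.H)
    (z : (Fin r → localTowerPointsOfEmb κ (closureEmb (K := ℚ) (v.adicCompletion ℚ)) W) →+ ℤ_[p])
    (hz : ∀ n, N₀ ≤ n → ∀ (Q : Fin r → localPoints W (v.adicCompletion ℚ))
      (hQ : ∀ i, Q i ∈ localLayerPointsOfEmb κ (closureEmb (K := ℚ) (v.adicCompletion ℚ)) W n),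
      pair n (I.proj n x) (fun i => ⟨Q i, hQ i⟩) =
        z (fun i => ⟨Q i, localLayerPointsOfEmb_le_localTowerPointsOfEmb κ _ W n (hQ i)⟩)) :
    locd x = z := by
  refine AddMonoidHom.ext fun Q => ?_
  obtain ⟨n₁, hn₁⟩ := exists_common_layer W v Q
  have hn : ∀ i, ((Q i : localPoints W (v.adicCompletion ℚ))) ∈
      localLayerPointsOfEmb κ (closureEmb (K := ℚ) (v.adicCompletion ℚ)) W (max n₁ N₀) :=
    fun i => Kobayashi2003.localLayerPointsOfEmb_mono κ _ W (le_max_left n₁ N₀) (hn₁ i)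
  have e : Q = fun i => ⟨(Q i : localPoints W (v.adicCompletion ℚ)),
      localLayerPointsOfEmb_le_localTowerPointsOfEmb κ _ W (max n₁ N₀) (hn i)⟩ :=
    funext fun i => Subtype.ext rfl
  rw [e, hlocd (max n₁ N₀) x _ hn, hz (max n₁ N₀) (le_max_right n₁ N₀) _ hn]

include hlocd in
/-- **Transfer = restriction, residue form (generic).** If for every `n ≥ N₀`, every `k` and every layer-`n` tuple `Q` the residues agree,
`(pair n (proj n x) Q) mod p^k = (z Q) mod p^k`, then `locd x = z` (`ℤ_p` is `p`-adically separated: `PadicInt.ext_of_toZModPow`).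
[cite: PerrinRiou1994Invent, §3.6.1] [cite: Kato2004Asterisque, §13.8 (pp. 228–229)] -/
theorem locd_eq_of_forall_toZModPow_eq_from (N₀ : ℕ) (x : I.H)
    (z : (Fin r → localTowerPointsOfEmb κ (closureEmb (K := ℚ) (v.adicCompletion ℚ)) W) →+ ℤ_[p])
    (hz : ∀ n, N₀ ≤ n → ∀ (k : ℕ) (Q : Fin r → localPoints W (v.adicCompletion ℚ))
      (hQ : ∀ i, Q i ∈ localLayerPointsOfEmb κ (closureEmb (K := ℚ) (v.adicCompletion ℚ)) W n),
      PadicInt.toZModPow k (pair n (I.proj n x) (fun i => ⟨Q i, hQ i⟩)) =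
        PadicInt.toZModPow k (z (fun i => ⟨Q i, localLayerPointsOfEmb_le_localTowerPointsOfEmb κ _ W n (hQ i)⟩))) :
    locd x = z :=
  locd_eq_of_forall_layer_from I W v pair hlocd N₀ x z fun n hn Q hQ =>
    PadicInt.ext_of_toZModPow.mp fun k => hz n hn k Q hQ

include hlocd in
/-- **Strict reading (generic, `z = 0`).** If the layer pairings of the projections of `x` vanish on every layer-`n` tuple, `n ≥ N₀`, then
`locd x = 0`. [cite: Kato2004Asterisque, §12.2 (p. 220)] [cite: Sprung2012, Lemma 7.10 (p. 1503)] -/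
theorem locd_eq_zero_of_forall_layer_from (N₀ : ℕ) (x : I.H)
    (hz : ∀ n, N₀ ≤ n → ∀ (Q : Fin r → localPoints W (v.adicCompletion ℚ))
      (hQ : ∀ i, Q i ∈ localLayerPointsOfEmb κ (closureEmb (K := ℚ) (v.adicCompletion ℚ)) W n),
      pair n (I.proj n x) (fun i => ⟨Q i, hQ i⟩) = 0) :
    locd x = 0 :=
  locd_eq_of_forall_layer_from I W v pair hlocd N₀ x 0 fun n hn Q hQ => by rw [hz n hn Q hQ, AddMonoidHom.zero_apply]

include hlocd in
/-- **Strict reading, residue form (generic).** If all residues `(pair n (proj n x) Q) mod p^k` vanish (`n ≥ N₀`, all `k`, all layer-`n`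
tuples), then `locd x = 0`. [cite: PerrinRiou1994Invent, §3.6.1] -/
theorem locd_eq_zero_of_forall_toZModPow_eq_zero_from (N₀ : ℕ) (x : I.H)
    (hz : ∀ n, N₀ ≤ n → ∀ (k : ℕ) (Q : Fin r → localPoints W (v.adicCompletion ℚ))
      (hQ : ∀ i, Q i ∈ localLayerPointsOfEmb κ (closureEmb (K := ℚ) (v.adicCompletion ℚ)) W n),
      PadicInt.toZModPow k (pair n (I.proj n x) (fun i => ⟨Q i, hQ i⟩)) = 0) :
    locd x = 0 :=
  locd_eq_of_forall_toZModPow_eq_from I W v pair hlocd N₀ x 0 fun n hn k Q hQ => by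
    rw [hz n hn k Q hQ, AddMonoidHom.zero_apply, map_zero]

/-- **The slack of the S4₂ text** (`∃ a ≠ 0, a • z = locd x`, STUB-PLAN S48 «expected `a = 1`»): an equality `locd x = z` gives the
`∃ a ≠ 0` form with `a = 1`. [folklore] -/
theorem exists_ne_zero_smul_eq_of_eq {x : I.H}
    {z : (Fin r → localTowerPointsOfEmb κ (closureEmb (K := ℚ) (v.adicCompletion ℚ)) W) →+ ℤ_[p]} (h : locd x = z) :
    ∃ a : ℤ_[p], a ≠ 0 ∧ a • z = locd x :=
  ⟨1, one_ne_zero, by rw [one_smul, h]⟩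

end Generic

/-! ## §2 `ρ`-coefficients with the residue pin: `rhoLayerPairingPk n k (proj n x) Q = (z Q) mod p^k` ⇒ `locd₂ x = z` -/

section Rho

variable {p : ℕ} [Fact p.Prime] (S : Set (PadicAlgCl p)) {d : ℕ} (ρ : FramedGaloisRep ℚ ↥(padicCoeffIntegers S) d)
  (W : WeierstrassCurve ℚ) [W.IsElliptic] {r : ℕ}
  (ePk : ∀ k : ℕ, ↥(AddSubgroup.torsionBy (Cofree ρ ↥(padicCoeffField S)) ((p ^ k : ℕ) : ℤ)) →
    ↥(AddSubgroup.torsionBy (Cofree ρ ↥(padicCoeffField S)) ((p ^ k : ℕ) : ℤ)) → AlgebraicClosure ℚ)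
  (hμPk : ∀ k a b, ePk k a b ^ (p ^ k) = 1)
  (hadd₁Pk : ∀ k a₁ a₂ b, ePk k (a₁ + a₂) b = ePk k a₁ b * ePk k a₂ b)
  (hadd₂Pk : ∀ k a b₁ b₂, ePk k a (b₁ + b₂) = ePk k a b₁ * ePk k a b₂)
  (hgalPk : ∀ k (σ : absoluteGaloisGroup ℚ) (a b : ↥(AddSubgroup.torsionBy (Cofree ρ ↥(padicCoeffField S)) ((p ^ k : ℕ) : ℤ))),
    σ • ePk k a b = ePk k (cofreeTorsionGaloisModule S ρ _ σ a) (cofreeTorsionGaloisModule S ρ _ σ b))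
  (Θ : Cofree ρ ↥(padicCoeffField S) ≃+ (Fin r → ↥(W.geomPrimaryTorsion p))) (κ : ZpExtension ℚ p)
  (v : HeightOneSpectrum (𝓞 ℚ))
  (hΘ : ∀ (δ : absoluteGaloisGroup (v.adicCompletion ℚ)) (m : Cofree ρ ↥(padicCoeffField S)) (i : Fin r),
    Θ (resGalOfEmb (closureEmb (K := ℚ) (v.adicCompletion ℚ)) δ • m) i =
      resGalOfEmb (closureEmb (K := ℚ) (v.adicCompletion ℚ)) δ • Θ m i)
  {γ : absoluteGaloisGroup ℚ} (I : IwasawaH1DataCoeff (FramedGaloisRep.toGaloisRep ρ) p κ γ)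
  (pair : ∀ m : ℕ, H1 (FramedGaloisRep.toGaloisRep ρ) (κ.layerSubgroup m) →+
    ((Fin r → localLayerPointsOfEmb κ (closureEmb (K := ℚ) (v.adicCompletion ℚ)) W m) →+ ℤ_[p]))
  (hpair : ∀ (m k : ℕ) (x : H1 (FramedGaloisRep.toGaloisRep ρ) (κ.layerSubgroup m))
    (Q : Fin r → localLayerPointsOfEmb κ (closureEmb (K := ℚ) (v.adicCompletion ℚ)) W m),
    PadicInt.toZModPow k (pair m x Q) = rhoLayerPairingPk S ρ W ePk hμPk hadd₁Pk hadd₂Pk hgalPk Θ κ v hΘ m k x Q)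
  {locd₂ : I.H →+ ((Fin r → localTowerPointsOfEmb κ (closureEmb (K := ℚ) (v.adicCompletion ℚ)) W) →+ ℤ_[p])}
  (hlocd : ∀ (m : ℕ) (x : I.H) (Q : Fin r → localPoints W (v.adicCompletion ℚ))
    (hQ : ∀ i, Q i ∈ localLayerPointsOfEmb κ (closureEmb (K := ℚ) (v.adicCompletion ℚ)) W m),
    locd₂ x (fun i => ⟨Q i, localLayerPointsOfEmb_le_localTowerPointsOfEmb κ _ W m (hQ i)⟩) = pair m (I.proj m x) (fun i => ⟨Q i, hQ i⟩))

include hpair hlocd in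
/-- **Transfer = restriction for the PINNED glue `locd₂`** (v2c binders `pair`/`hpair`/`locd₂`/`hlocd`): if the `ρ`-coefficient layer Tate
pairings of the projections of `x ∈ 𝐇¹_Γ(T_ρ)` have the residues of ONE functional `z` — `rhoLayerPairingPk … n k (proj n x) Q = (z Q) mod p^k`
for all `k`, all layer-`n` tuples `Q`, all `n ≥ N₀` — then `locd₂ x = z`. [cite: Kato2004Asterisque, §13.8 (pp. 228–229), §17.13 (p. 279)]
[cite: PerrinRiou1994Invent, §3.6.1] [cite: Kobayashi2003, (8.23) (p. 18)] -/
theorem locd₂_eq_of_forall_rhoLayerPairingPk_eq_from (N₀ : ℕ) (x : I.H)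
    (z : (Fin r → localTowerPointsOfEmb κ (closureEmb (K := ℚ) (v.adicCompletion ℚ)) W) →+ ℤ_[p])
    (hz : ∀ n, N₀ ≤ n → ∀ (k : ℕ) (Q : Fin r → localPoints W (v.adicCompletion ℚ))
      (hQ : ∀ i, Q i ∈ localLayerPointsOfEmb κ (closureEmb (K := ℚ) (v.adicCompletion ℚ)) W n),
      rhoLayerPairingPk S ρ W ePk hμPk hadd₁Pk hadd₂Pk hgalPk Θ κ v hΘ n k (I.proj n x) (fun i => ⟨Q i, hQ i⟩) =
        PadicInt.toZModPow k (z (fun i => ⟨Q i, localLayerPointsOfEmb_le_localTowerPointsOfEmb κ _ W n (hQ i)⟩))) :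
    locd₂ x = z :=
  locd_eq_of_forall_toZModPow_eq_from I W v pair hlocd N₀ x z fun n hn k Q hQ => by
    rw [hpair]; exact hz n hn k Q hQ

include hpair hlocd in
/-- **Strict reading for the pinned glue**: if all residues `rhoLayerPairingPk … n k (proj n x) Q` vanish (`n ≥ N₀`), then `locd₂ x = 0`.
[cite: Kato2004Asterisque, §13.8 (pp. 228–229)] [cite: PerrinRiou1994Invent, §3.6.1] -/
theorem locd₂_eq_zero_of_forall_rhoLayerPairingPk_eq_zero_from (N₀ : ℕ) (x : I.H)
    (hz : ∀ n, N₀ ≤ n → ∀ (k : ℕ) (Q : Fin r → localPoints W (v.adicCompletion ℚ))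
      (hQ : ∀ i, Q i ∈ localLayerPointsOfEmb κ (closureEmb (K := ℚ) (v.adicCompletion ℚ)) W n),
      rhoLayerPairingPk S ρ W ePk hμPk hadd₁Pk hadd₂Pk hgalPk Θ κ v hΘ n k (I.proj n x) (fun i => ⟨Q i, hQ i⟩) = 0) :
    locd₂ x = 0 :=
  locd_eq_zero_of_forall_toZModPow_eq_zero_from I W v pair hlocd N₀ x fun n hn k Q hQ => by
    rw [hpair]; exact hz n hn k Q hQ

/-! ## §3 The value condition on torsion classes: `red_{p^k}` reading, `[p]_*`-stability, `Cor`-stability -/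

/-- **The value condition read on a reduction**: for `y ∈ H¹(Γ_n, T_ρ)`, the torsion class `red_{p^k} y` pairs with the Θ-Kummer class of a
layer tuple `Q` to `rhoLayerPairingPk … n k y Q` (unfolding, `rhoLayerPairingPk_apply`). So «`red_{p^k}(proj_n x)` satisfies the value
condition for `z`» IS «`rhoLayerPairingPk n k (proj n x) Q = (z Q) mod p^k`». [cite: Kobayashi2003, (8.23) (p. 18)]
[cite: Kato2004Asterisque, §13.8 (pp. 228–229)] -/
theorem layerPairingH1Of_layerLocOf_reduce_thetaLayerKummer (n k : ℕ) (y : H1 (FramedGaloisRep.toGaloisRep ρ) (κ.layerSubgroup n))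
    (Q : Fin r → localLayerPointsOfEmb κ (closureEmb (K := ℚ) (v.adicCompletion ℚ)) W n) :
    layerPairingH1Of (cofreeTorsionGaloisModule S ρ ((p ^ k : ℕ) : ℤ)) (p ^ k) (ePk k) (hμPk k) (hadd₁Pk k) (hadd₂Pk k) (hgalPk k) κ v n
        (layerLocOf (cofreeTorsionGaloisModule S ρ ((p ^ k : ℕ) : ℤ)) κ v n
          (reduceH1CofreePkTorsion S ρ k (κ.layerSubgroup n) y : H1 (cofreeTorsionGaloisModule S ρ ((p ^ k : ℕ) : ℤ)) (κ.layerSubgroup n)))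
        (thetaLayerKummer S ρ k W Θ κ v hΘ n Q) =
      rhoLayerPairingPk S ρ W ePk hμPk hadd₁Pk hadd₂Pk hgalPk Θ κ v hΘ n k y Q :=
  (rhoLayerPairingPk_apply S ρ W ePk hμPk hadd₁Pk hadd₂Pk hgalPk Θ κ v hΘ n k y Q).symm

set_option maxHeartbeats 400000 in
-- two elaborations of `⟨loc_n c, thetaLayerKummer Q⟩_{n,p^{k+1}}` (this file's binder `hc` vs. the generic `layerPairingH1Of_succ_compat`)
-- meet in one `rw`; their instance paths on the torsion subtype `A_ρ[p^k]` unify slowly (as in `…RhoLayerPairingProjection` §2, p679036)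
/-- **`[p]_*`-stability of the value condition** (the value part of `hSk`): for a TOWER of pairing data (`e_k(pa, pb) = e_{k+1}(a, b)^p`), if
`c ∈ H¹(Γ_n, A_ρ[p^{k+1}])` pairs with the Θ-Kummer classes of all layer-`n` tuples to `(z Q) mod p^{k+1}`, then `[p]_* c ∈ H¹(Γ_n, A_ρ[p^k])`
pairs with them to `(z Q) mod p^k` — naturality of `loc_n` in the coefficients (`layerLocOf_cohomologyMap`), level compatibility of the layer
pairing (`layerPairingH1Of_succ_compat`), `[p]_*` of the Θ-Kummer class (`cohomologyMap_cofreeTorsionLocalPow_thetaLayerKummer`) and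
`PadicInt.cast_toZModPow`. [cite: Kato2004Asterisque, §13.8 (pp. 228–229)] [cite: PerrinRiou1994Invent, §3.6.1]
[cite: SerreLocalFields1979, XIII §3] -/
theorem valueCond_cohomologyMap_cofreeTorsionPow
    (htower : ∀ k (a b : ↥(AddSubgroup.torsionBy (Cofree ρ ↥(padicCoeffField S)) ((p ^ (k + 1) : ℕ) : ℤ))),
      ePk k ((cofreeTorsionPow S ρ k).hom a) ((cofreeTorsionPow S ρ k).hom b) = ePk (k + 1) a b ^ p)
    (n k : ℕ) (z : (Fin r → localTowerPointsOfEmb κ (closureEmb (K := ℚ) (v.adicCompletion ℚ)) W) →+ ℤ_[p])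
    (c : H1 (cofreeTorsionGaloisModule S ρ ((p ^ (k + 1) : ℕ) : ℤ)) (κ.layerSubgroup n))
    (hc : ∀ (Q : Fin r → localPoints W (v.adicCompletion ℚ))
      (hQ : ∀ i, Q i ∈ localLayerPointsOfEmb κ (closureEmb (K := ℚ) (v.adicCompletion ℚ)) W n),
      layerPairingH1Of (cofreeTorsionGaloisModule S ρ ((p ^ (k + 1) : ℕ) : ℤ)) (p ^ (k + 1)) (ePk (k + 1)) (hμPk (k + 1))
          (hadd₁Pk (k + 1)) (hadd₂Pk (k + 1)) (hgalPk (k + 1)) κ v n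
          (layerLocOf (cofreeTorsionGaloisModule S ρ ((p ^ (k + 1) : ℕ) : ℤ)) κ v n c)
          (thetaLayerKummer S ρ (k + 1) W Θ κ v hΘ n (fun i => ⟨Q i, hQ i⟩)) =
        PadicInt.toZModPow (k + 1) (z (fun i => ⟨Q i, localLayerPointsOfEmb_le_localTowerPointsOfEmb κ _ W n (hQ i)⟩)))
    (Q : Fin r → localPoints W (v.adicCompletion ℚ))
    (hQ : ∀ i, Q i ∈ localLayerPointsOfEmb κ (closureEmb (K := ℚ) (v.adicCompletion ℚ)) W n) :
    layerPairingH1Of (cofreeTorsionGaloisModule S ρ ((p ^ k : ℕ) : ℤ)) (p ^ k) (ePk k) (hμPk k) (hadd₁Pk k) (hadd₂Pk k) (hgalPk k) κ v n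
        (layerLocOf (cofreeTorsionGaloisModule S ρ ((p ^ k : ℕ) : ℤ)) κ v n
          (cohomologyMap (subgroupRepMap (cofreeTorsionPow S ρ k) (κ.layerSubgroup n)) 1 c))
        (thetaLayerKummer S ρ k W Θ κ v hΘ n (fun i => ⟨Q i, hQ i⟩)) =
      PadicInt.toZModPow k (z (fun i => ⟨Q i, localLayerPointsOfEmb_le_localTowerPointsOfEmb κ _ W n (hQ i)⟩)) := by
  rw [← PadicInt.cast_toZModPow k (k + 1) (Nat.le_succ k), ← hc Q hQ,
    layerPairingH1Of_succ_compat k (cofreeTorsionGaloisModule S ρ ((p ^ (k + 1) : ℕ) : ℤ))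
      (cofreeTorsionGaloisModule S ρ ((p ^ k : ℕ) : ℤ)) (cofreeTorsionPow S ρ k) (ePk (k + 1)) (hμPk (k + 1)) (hadd₁Pk (k + 1))
      (hadd₂Pk (k + 1)) (hgalPk (k + 1)) (ePk k) (hμPk k) (hadd₁Pk k) (hadd₂Pk k) (hgalPk k) (htower k) κ v n,
    layerLocOf_cohomologyMap]
  change layerPairingH1Of _ (p ^ k) (ePk k) (hμPk k) (hadd₁Pk k) (hadd₂Pk k) (hgalPk k) κ v n
      (cohomologyMap (subgroupRepMap (cofreeTorsionLocalPow S ρ k v) (layerGroup κ v n)) 1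
        (layerLocOf (cofreeTorsionGaloisModule S ρ ((p ^ (k + 1) : ℕ) : ℤ)) κ v n c))
      (thetaLayerKummer S ρ k W Θ κ v hΘ n fun i => ⟨Q i, hQ i⟩) =
    layerPairingH1Of _ (p ^ k) (ePk k) (hμPk k) (hadd₁Pk k) (hadd₂Pk k) (hgalPk k) κ v n
      (cohomologyMap (subgroupRepMap (cofreeTorsionLocalPow S ρ k v) (layerGroup κ v n)) 1
        (layerLocOf (cofreeTorsionGaloisModule S ρ ((p ^ (k + 1) : ℕ) : ℤ)) κ v n c))
      (cohomologyMap (subgroupRepMap (cofreeTorsionLocalPow S ρ k v) (layerGroup κ v n)) 1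
        (thetaLayerKummer S ρ (k + 1) W Θ κ v hΘ n fun i => ⟨Q i, hQ i⟩))
  rw [cohomologyMap_cofreeTorsionLocalPow_thetaLayerKummer]

/-- **`Cor`-stability of the value condition at `v ∣ p`** (the value part of `hSn`; cyclotomic `κ`): if `c ∈ H¹(Γ_{n+1}, A_ρ[p^k])` pairs with
the Θ-Kummer classes of all layer-`(n+1)` tuples to `(z Q) mod p^k`, then `cor c ∈ H¹(Γ_n, A_ρ[p^k])` pairs with the Θ-Kummer classes of all
layer-`n` tuples to `(z Q) mod p^k` — the projection formula (P1) `layerPairingOf_layerCores` and `resLe_thetaLayerKummer` (a layer-`n` tuple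
is a layer-`(n+1)` tuple with the same image in the tower). [cite: Kato2004Asterisque, §12.2 (p. 220)] [cite: Kobayashi2003, (8.23) (p. 18)]
[cite: NeukirchSchmidtWingberg2008, I §5 Prop. (1.5.3)(iv)] -/
theorem valueCond_layerCores (hκ : κ.IsCyclotomic) (hv : (p : 𝓞 ℚ) ∈ v.asIdeal) (n k : ℕ)
    (z : (Fin r → localTowerPointsOfEmb κ (closureEmb (K := ℚ) (v.adicCompletion ℚ)) W) →+ ℤ_[p])
    (c : H1 (cofreeTorsionGaloisModule S ρ ((p ^ k : ℕ) : ℤ)) (κ.layerSubgroup (n + 1)))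
    (hc : ∀ (Q : Fin r → localPoints W (v.adicCompletion ℚ))
      (hQ : ∀ i, Q i ∈ localLayerPointsOfEmb κ (closureEmb (K := ℚ) (v.adicCompletion ℚ)) W (n + 1)),
      layerPairingH1Of (cofreeTorsionGaloisModule S ρ ((p ^ k : ℕ) : ℤ)) (p ^ k) (ePk k) (hμPk k) (hadd₁Pk k) (hadd₂Pk k) (hgalPk k) κ v
          (n + 1) (layerLocOf (cofreeTorsionGaloisModule S ρ ((p ^ k : ℕ) : ℤ)) κ v (n + 1) c)
          (thetaLayerKummer S ρ k W Θ κ v hΘ (n + 1) (fun i => ⟨Q i, hQ i⟩)) =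
        PadicInt.toZModPow k (z (fun i => ⟨Q i, localLayerPointsOfEmb_le_localTowerPointsOfEmb κ _ W (n + 1) (hQ i)⟩)))
    (Q : Fin r → localPoints W (v.adicCompletion ℚ))
    (hQ : ∀ i, Q i ∈ localLayerPointsOfEmb κ (closureEmb (K := ℚ) (v.adicCompletion ℚ)) W n) :
    layerPairingH1Of (cofreeTorsionGaloisModule S ρ ((p ^ k : ℕ) : ℤ)) (p ^ k) (ePk k) (hμPk k) (hadd₁Pk k) (hadd₂Pk k) (hgalPk k) κ v n
        (layerLocOf (cofreeTorsionGaloisModule S ρ ((p ^ k : ℕ) : ℤ)) κ v n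
          (layerCores (cofreeTorsionGaloisModule S ρ ((p ^ k : ℕ) : ℤ)) κ n c))
        (thetaLayerKummer S ρ k W Θ κ v hΘ n (fun i => ⟨Q i, hQ i⟩)) =
      PadicInt.toZModPow k (z (fun i => ⟨Q i, localLayerPointsOfEmb_le_localTowerPointsOfEmb κ _ W n (hQ i)⟩)) := by
  -- the (P1) instance and the Θ-Kummer restriction are stated first with all arguments explicit (keeps the dialect bridge
  -- `cofreeTorsionLocalRep = localRepOf (cofreeTorsionGaloisModule …)` out of the `rw` unifier; default heartbeats)
  have hP1 := layerPairingOf_layerCores (cofreeTorsionGaloisModule S ρ ((p ^ k : ℕ) : ℤ)) (p ^ k) (ePk k) (hμPk k) (hadd₁Pk k)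
    (hadd₂Pk k) (hgalPk k) κ v hκ hv n c (thetaLayerKummer S ρ k W Θ κ v hΘ n fun i => ⟨Q i, hQ i⟩)
  have hθ := resLe_thetaLayerKummer S ρ k W Θ κ v hΘ n Q hQ
  rw [← layerPairingOf_apply, hP1, hθ, layerPairingOf_apply]
  exact hc Q fun i => Kobayashi2003.localLayerPointsOfEmb_mono κ (closureEmb (K := ℚ) (v.adicCompletion ℚ)) W (Nat.le_succ n) (hQ i)

/-! ## §4 Sol-form transfer and the composite with the Kőnig bookkeeping -/

include hpair hlocd in
/-- **Sol-form transfer.** If the reductions `red_{p^k}(proj_n x)` lie, for all `n ≥ N₀` and all `k`, in solution sets `Sol n k` all of whose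
members satisfy the value condition for `z` at the place `v`, then `locd₂ x = z`. [cite: Kato2004Asterisque, §13.8 (pp. 228–229)]
[cite: PerrinRiou1994Invent, §3.6.1] [cite: Kobayashi2003, (8.23) (p. 18)] -/
theorem locd₂_eq_of_forall_reduce_proj_mem_from (N₀ : ℕ)
    (Sol : ∀ n k : ℕ, Set (H1 (cofreeTorsionGaloisModule S ρ ((p ^ k : ℕ) : ℤ)) (κ.layerSubgroup n)))
    (z : (Fin r → localTowerPointsOfEmb κ (closureEmb (K := ℚ) (v.adicCompletion ℚ)) W) →+ ℤ_[p])
    (hSol : ∀ n k, N₀ ≤ n → ∀ c ∈ Sol n k, ∀ (Q : Fin r → localPoints W (v.adicCompletion ℚ))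
      (hQ : ∀ i, Q i ∈ localLayerPointsOfEmb κ (closureEmb (K := ℚ) (v.adicCompletion ℚ)) W n),
      layerPairingH1Of (cofreeTorsionGaloisModule S ρ ((p ^ k : ℕ) : ℤ)) (p ^ k) (ePk k) (hμPk k) (hadd₁Pk k) (hadd₂Pk k) (hgalPk k) κ v n
          (layerLocOf (cofreeTorsionGaloisModule S ρ ((p ^ k : ℕ) : ℤ)) κ v n c)
          (thetaLayerKummer S ρ k W Θ κ v hΘ n (fun i => ⟨Q i, hQ i⟩)) =
        PadicInt.toZModPow k (z (fun i => ⟨Q i, localLayerPointsOfEmb_le_localTowerPointsOfEmb κ _ W n (hQ i)⟩)))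
    (x : I.H)
    (hx : ∀ n k, N₀ ≤ n → (reduceH1CofreePkTorsion S ρ k (κ.layerSubgroup n) (I.proj n x) :
        H1 (cofreeTorsionGaloisModule S ρ ((p ^ k : ℕ) : ℤ)) (κ.layerSubgroup n)) ∈ Sol n k) :
    locd₂ x = z :=
  locd₂_eq_of_forall_rhoLayerPairingPk_eq_from S ρ W ePk hμPk hadd₁Pk hadd₂Pk hgalPk Θ κ v hΘ I pair hpair hlocd N₀ x z
    fun n hn k Q hQ => by
      rw [← layerPairingH1Of_layerLocOf_reduce_thetaLayerKummer]
      exact hSol n k hn _ (hx n k hn) Q hQ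

include hpair hlocd in
/-- **Levelwise solution sets with the value condition ⇒ `x : 𝐇¹_Γ(T_ρ)` with `locd₂ x = z`** (composite of the bridge-free Kőnig bookkeeping
`exists_iwasawaH1_of_levelwise_from` — `𝒪` compact, `κ` cyclotomic — and the Sol-form transfer): finite, diagonally non-empty, `[p]_*`- and
`Cor`-stable solution sets `Sol n k ⊆ H¹(ℚ_n, A_ρ[p^k])` from the floor `N₀` all of whose members satisfy the value condition for `z` at `v`
yield `x : I.H` with `locd₂ x = z` and `red_{p^k}(proj_n x) ∈ Sol n k` for every `N₀ ≤ n` (the membership is kept for the `S₀`-side reading of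
the same `x`). The diagonal non-emptiness `hne` is the arithmetic (Poitou–Tate) input of the deep-half stubs and stays a hypothesis.
[cite: Kato2004Asterisque, Lemma 8.5 (2) (p. 183), §12.2 (p. 220), §13.8 (p. 228)] [cite: Rubin2000, App. B Prop. B.2.3, §B.3]
[cite: PerrinRiou1994Invent, §3.6.1] -/
theorem exists_iwasawaH1_locd₂_eq_of_levelwise_from [CompactSpace ↥(padicCoeffIntegers S)] (hκ : κ.IsCyclotomic) (N₀ : ℕ)
    (Sol : ∀ n k : ℕ, Set (H1 (cofreeTorsionGaloisModule S ρ ((p ^ k : ℕ) : ℤ)) (κ.layerSubgroup n)))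
    (hfin : ∀ n k, N₀ ≤ n → (Sol n k).Finite) (hne : ∀ j, N₀ ≤ j → (Sol j j).Nonempty)
    (hSk : ∀ n k, N₀ ≤ n →
      ∀ c ∈ Sol n (k + 1), cohomologyMap (subgroupRepMap (cofreeTorsionPow S ρ k) (κ.layerSubgroup n)) 1 c ∈ Sol n k)
    (hSn : ∀ n k, N₀ ≤ n →
      ∀ c ∈ Sol (n + 1) k, layerCores (cofreeTorsionGaloisModule S ρ ((p ^ k : ℕ) : ℤ)) κ n c ∈ Sol n k)
    (z : (Fin r → localTowerPointsOfEmb κ (closureEmb (K := ℚ) (v.adicCompletion ℚ)) W) →+ ℤ_[p])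
    (hSol : ∀ n k, N₀ ≤ n → ∀ c ∈ Sol n k, ∀ (Q : Fin r → localPoints W (v.adicCompletion ℚ))
      (hQ : ∀ i, Q i ∈ localLayerPointsOfEmb κ (closureEmb (K := ℚ) (v.adicCompletion ℚ)) W n),
      layerPairingH1Of (cofreeTorsionGaloisModule S ρ ((p ^ k : ℕ) : ℤ)) (p ^ k) (ePk k) (hμPk k) (hadd₁Pk k) (hadd₂Pk k) (hgalPk k) κ v n
          (layerLocOf (cofreeTorsionGaloisModule S ρ ((p ^ k : ℕ) : ℤ)) κ v n c)
          (thetaLayerKummer S ρ k W Θ κ v hΘ n (fun i => ⟨Q i, hQ i⟩)) =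
        PadicInt.toZModPow k (z (fun i => ⟨Q i, localLayerPointsOfEmb_le_localTowerPointsOfEmb κ _ W n (hQ i)⟩))) :
    ∃ x : I.H, locd₂ x = z ∧ ∀ n k, N₀ ≤ n → (reduceH1CofreePkTorsion S ρ k (κ.layerSubgroup n) (I.proj n x) :
        H1 (cofreeTorsionGaloisModule S ρ ((p ^ k : ℕ) : ℤ)) (κ.layerSubgroup n)) ∈ Sol n k := by
  obtain ⟨x, hx⟩ := exists_iwasawaH1_of_levelwise_from S ρ κ hκ I N₀ Sol hfin hne hSk hSn
  exact ⟨x, locd₂_eq_of_forall_reduce_proj_mem_from S ρ W ePk hμPk hadd₁Pk hadd₂Pk hgalPk Θ κ v hΘ I pair hpair hlocd N₀ Sol z hSol x hx, hx⟩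

include hpair hlocd in
/-- `exists_iwasawaH1_locd₂_eq_of_levelwise_from` under the newform habitat's standing hypothesis `[FiniteDimensional ℚ_[p] ℚ_p(S)]`
(`UniversalNorms.compactSpace_padicCoeffIntegers`). [cite: Kato2004Asterisque, Lemma 8.5 (2) (p. 183), §12.2 (p. 220)]
[cite: Rubin2000, App. B Prop. B.2.3, §B.3] -/
theorem exists_iwasawaH1_locd₂_eq_of_levelwise_from_of_finiteDimensional [FiniteDimensional ℚ_[p] ↥(padicCoeffField S)]
    (hκ : κ.IsCyclotomic) (N₀ : ℕ)
    (Sol : ∀ n k : ℕ, Set (H1 (cofreeTorsionGaloisModule S ρ ((p ^ k : ℕ) : ℤ)) (κ.layerSubgroup n)))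
    (hfin : ∀ n k, N₀ ≤ n → (Sol n k).Finite) (hne : ∀ j, N₀ ≤ j → (Sol j j).Nonempty)
    (hSk : ∀ n k, N₀ ≤ n →
      ∀ c ∈ Sol n (k + 1), cohomologyMap (subgroupRepMap (cofreeTorsionPow S ρ k) (κ.layerSubgroup n)) 1 c ∈ Sol n k)
    (hSn : ∀ n k, N₀ ≤ n →
      ∀ c ∈ Sol (n + 1) k, layerCores (cofreeTorsionGaloisModule S ρ ((p ^ k : ℕ) : ℤ)) κ n c ∈ Sol n k)
    (z : (Fin r → localTowerPointsOfEmb κ (closureEmb (K := ℚ) (v.adicCompletion ℚ)) W) →+ ℤ_[p])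
    (hSol : ∀ n k, N₀ ≤ n → ∀ c ∈ Sol n k, ∀ (Q : Fin r → localPoints W (v.adicCompletion ℚ))
      (hQ : ∀ i, Q i ∈ localLayerPointsOfEmb κ (closureEmb (K := ℚ) (v.adicCompletion ℚ)) W n),
      layerPairingH1Of (cofreeTorsionGaloisModule S ρ ((p ^ k : ℕ) : ℤ)) (p ^ k) (ePk k) (hμPk k) (hadd₁Pk k) (hadd₂Pk k) (hgalPk k) κ v n
          (layerLocOf (cofreeTorsionGaloisModule S ρ ((p ^ k : ℕ) : ℤ)) κ v n c)
          (thetaLayerKummer S ρ k W Θ κ v hΘ n (fun i => ⟨Q i, hQ i⟩)) =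
        PadicInt.toZModPow k (z (fun i => ⟨Q i, localLayerPointsOfEmb_le_localTowerPointsOfEmb κ _ W n (hQ i)⟩))) :
    ∃ x : I.H, locd₂ x = z ∧ ∀ n k, N₀ ≤ n → (reduceH1CofreePkTorsion S ρ k (κ.layerSubgroup n) (I.proj n x) :
        H1 (cofreeTorsionGaloisModule S ρ ((p ^ k : ℕ) : ℤ)) (κ.layerSubgroup n)) ∈ Sol n k :=
  haveI := UniversalNorms.compactSpace_padicCoeffIntegers S
  exists_iwasawaH1_locd₂_eq_of_levelwise_from S ρ W ePk hμPk hadd₁Pk hadd₂Pk hgalPk Θ κ v hΘ I pair hpair hlocd hκ N₀ Sol hfin hne hSk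
    hSn z hSol

end Rho

end Summit.BirchSwinnertonDyer.BirchSwinnertonDyer.Theorems.ThetaTransport.DeepHalfTransfer

end
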